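import Mathlib
import HarnessLib
import Summits.HubbardSuperconductivity.HubbardSuperconductivity.Theorems.KLProgrammeKLRegimeEnginePairTransferDLineEdgeTwoShell

/-!
# Route `KLProgramme` — ENGINE item stmt-HubbardSuperconductivity-20437 `KLRegimeEngineV17F2`, class-#5 STEP (X).3, located-risk #14 TAIL («(X).3-TAIL-SHARP»):
# the edge two-shell law for the `D`-line masses `WDd / WDx` with the PARTNER RADIUS A PARAMETER `ε₂′` (`Λ(t) ≤ ε₂′`, `2Λ_{j′} ≤ ε₂′`, `ε₂′ + Gδ ≤ klE0`)
# (cell gate-hubbard-kl, seat hubbard-kl-k3c2-p2 g23; generalises g20's `WDd/WDx_sum_le_twoShell_edge` (…DLineEdgeTwoShell), which is the instance `ε₂′ = Λₙ`)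

WHY.  The pinned TAIL rows of the (X).3 one-call (k3c1-p1 «88b», S11″ `…ConvWDDPinnedAll`) read g20's `WDd/WDx_edge_row_le_slots`, whose two-shell factor
`(Λₙ + Gδ)/r` is taken at the t-INDEPENDENT partner shell `ε₂′ = Λₙ` against the slice-line prefactor `1/Λ(t)²`, worst at `t = 1` (`Λ(1) = Λₙ₊₁ = Λₙ/4`).  But the
partner constraint that the proof actually produces is `|e_K(p_{k̃∓w̃})| ≤ Λ(t)` (the support of the slice line `ẇ_{Λ(t)}`), and the two-shell package only asks
`2Λ_{j′} ≤ ε₂′`; so at every `t` the partner shell `ε₂′(t) = max(Λ(t), 2Λ_{j′})` is admissible, and `Λₙ₊₁·(ε₂′(t) + Gδ)/Λ(t)² ≤ 3` uniformly in `t` (vs `≤ 20` for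
`ε₂′ = Λₙ`, read as `32` by the interior arithmetic) — the input of the companion `…DLineEdgeRoomReadingSharp` (`32c²G² ↦ 3c²G²` in the ROOM's `min` slot).
This file is g20's proof VERBATIM with `ε₂′` a parameter:
* **`WDd_sum_le_twoShell_edge_gen`** — `n + 1 ≤ j′ ≤ j`, `t ∈ [0,1]`, `Λ(t) ≤ ε₂′`, `2Λ_{j′} ≤ ε₂′`, `ε₂′ + Gδ ≤ klE0`, `0 < r ≤ |x − y|_𝕋`:
  `WDd(t,x,y) ≤ (512/3)(βL²)²/Λ(t)²·(9AL²/(2π²))·((ε₂′+Gδ)/r + √(ε₂′+Gδ))·[(βΛ_{j′}/π)(10+2Gβ/L) + 12Gβ/L]`;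
* **`WDx_sum_le_twoShell_edge_gen`** — the crossed twin at transfer `x + y − Q_m` (`256/3`).
Counting/arithmetic over landed packages (`twoShell_weighted_sum_le_of_le`, `dirProd/crossProd_le_indicator`); nothing about the model's kernel sizes is asserted;
nothing asserts (X).3, (c), K3 or superconductivity.  0 kit · 0 lit.
-/

noncomputable section

namespace Summit.HubbardSuperconductivity.HubbardSuperconductivity.Theorems.KLRegimeSplit

set_option linter.dupNamespace false -- summit = problem name (single-conjunct summit), D-0017

open Real Finset Set Literature.MathematicalPhysics.QuantumLattice Literature.Probability.LatticeModels
open Literature.MathematicalPhysics.QuantumLattice.FermiRG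
open Summit.HubbardSuperconductivity.HubbardSuperconductivity.Theorems.KLProgrammeLegKernels
open Summit.HubbardSuperconductivity.HubbardSuperconductivity.Theorems.TwoPointAssembly
open Summit.HubbardSuperconductivity.HubbardSuperconductivity.Theorems.DispersionFlow
open Summit.HubbardSuperconductivity.HubbardSuperconductivity.Theorems.KLRegimeWick
open Summit.HubbardSuperconductivity.HubbardSuperconductivity.Theorems.EngineV8

variable {L M : ℕ} (β μ : ℝ) (K : TrigPolyC4v)

/-! ## The `D`-rows above threshold for every `n + 1 ≤ j′ ≤ j`: the two-shell law with a general partner radius `ε₂′` -/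

/-- **`WDd ≤` the weighted two-shell mass at a general partner radius, every pair `n + 1 ≤ j′ ≤ j` (edge included).**  For `TwoShellFrameAreaAt A u`
(`0 ≤ A`), `R.WF2`, `0 < U ≤ u R`, `μ ∈ klWindowC`, `FrameOK R U N μ K`, `0 < β`, `n + 1 ≤ j′ ≤ j`, `t ∈ [0,1]`, a partner radius `ε₂′` with `Λ(t) ≤ ε₂′`,
`2Λ_{j′} ≤ ε₂′`, `ε₂′ + Gδ ≤ klE0`, and `0 < r ≤ |x − y|_𝕋`:
`WDd(t,x,y) ≤ (512/3)·(βL²)²/Λ(t)²·(9AL²/(2π²))·((ε₂′+Gδ)/r + √(ε₂′+Gδ))·[(βΛ_{j′}/π)(10 + 2Gβ/L) + 12Gβ/L]`. -/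
theorem WDd_sum_le_twoShell_edge_gen [NeZero L] [NeZero M] {A : ℝ} {u : RenConsts → ℝ} (h : TwoShellFrameAreaAt A u) (hA : 0 ≤ A) {R : RenConsts}
    (hR : R.WF2) {U : ℝ} (hU : 0 < U) (hUu : U ≤ u R) (hμ : μ ∈ klWindowC) {N : ℕ} (hK : FrameOK R U N μ K) (hβ : 0 < β)
    (n : ℕ) {j j' : ℕ} (hjj : j' ≤ j) {t : ℝ} (ht : t ∈ Icc (0 : ℝ) 1) {ε₂' : ℝ}
    (hε : klScale klE0 n + t * (klScale klE0 (n + 1) - klScale klE0 n) ≤ ε₂') (h2Λ : 2 * klScale klE0 j' ≤ ε₂')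
    (hE0 : ε₂' + (4 + 8 / 3 * R.Gfr 1 * U ^ 2) * (2 * π / L) ≤ klE0) {x y : TorusSite 2 L} {r : ℝ} (hr : 0 < r)
    (hrw : r ≤ klTorusNorm L (x - y)) :
    ∑ p : FreqMomentum L M, ∑ _σ : Fin 2, ∑ p' : FreqMomentum L M,
      (if matsubaraInt M p'.1 + matsubaraInt M (omega0 M) = matsubaraInt M p.1 + matsubaraInt M (omega0 M) ∧ p'.2 = p.2 + x - y then
        ‖((((softSymbolCompl L M β μ K (n + 1) j p - softSymbolCompl L M β μ K (n + 1) j' p : ℝ)) : ℂ) * (((β * (L : ℝ) ^ 2 : ℝ) : ℂ) * propCT L M β μ K p)) *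
            ((((deriv (fun Λ' : ℝ => hubbardCutoffWeightCT L M β μ K Λ' p') (klScale klE0 n + t * (klScale klE0 (n + 1) - klScale klE0 n)) : ℝ)) : ℂ) *
              (((β * (L : ℝ) ^ 2 : ℝ) : ℂ) * propCT L M β μ K p')) +
          ((((deriv (fun Λ' : ℝ => hubbardCutoffWeightCT L M β μ K Λ' p) (klScale klE0 n + t * (klScale klE0 (n + 1) - klScale klE0 n)) : ℝ)) : ℂ) *
              (((β * (L : ℝ) ^ 2 : ℝ) : ℂ) * propCT L M β μ K p)) *
            ((((softSymbolCompl L M β μ K (n + 1) j p' - softSymbolCompl L M β μ K (n + 1) j' p' : ℝ)) : ℂ) * (((β * (L : ℝ) ^ 2 : ℝ) : ℂ) * propCT L M β μ K p'))‖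
      else 0) ≤
      512 / 3 * (β * (L : ℝ) ^ 2) ^ 2 / (klScale klE0 n + t * (klScale klE0 (n + 1) - klScale klE0 n)) ^ 2 *
        (9 * A * (L : ℝ) ^ 2 / (2 * π ^ 2) *
          ((ε₂' + (4 + 8 / 3 * R.Gfr 1 * U ^ 2) * (2 * π / L)) / r +
            Real.sqrt (ε₂' + (4 + 8 / 3 * R.Gfr 1 * U ^ 2) * (2 * π / L))) *
          (β * klScale klE0 j' / π * (10 + 2 * (4 + 8 / 3 * R.Gfr 1 * U ^ 2) * β / L) + 12 * (4 + 8 / 3 * R.Gfr 1 * U ^ 2) * β / L)) := by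
  classical
  set Λ : ℝ := klScale klE0 n + t * (klScale klE0 (n + 1) - klScale klE0 n) with hΛdef
  have hΛ : 0 < Λ := scaleAt_pos n ht
  have hβL : 0 < β * (L : ℝ) ^ 2 := by
    have : (0 : ℝ) < L := by exact_mod_cast Nat.pos_of_ne_zero (NeZero.ne L)
    positivity
  set G : ℝ := 4 + 8 / 3 * R.Gfr 1 * U ^ 2 with hG
  set q : TorusSite 2 L := x - y with hq
  have hj'0 := klth_klScale_pos j'
  -- the weighted two-shell bound at `(Λ′, ε₂, ε₂′) = (Λ_{j′}, Λ, Λₙ)`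
  set W : ℝ := 9 * A * (L : ℝ) ^ 2 / (2 * π ^ 2) * ((ε₂' + G * (2 * π / L)) / r + Real.sqrt (ε₂' + G * (2 * π / L))) *
      (β * klScale klE0 j' / π * (10 + 2 * G * β / L) + 12 * G * β / L) with hW
  have hWq : ∑ p ∈ univ.filter (fun p : FreqMomentum L M => matsubaraFreq β M p.1 ^ 2 + nambuXiCT L μ K p.2 ^ 2 ≤ klScale klE0 j' ^ 2 ∧
      |nambuXiCT L μ K (p.2 - q)| ≤ Λ), (Real.sqrt (matsubaraFreq β M p.1 ^ 2 + nambuXiCT L μ K p.2 ^ 2))⁻¹ ≤ W :=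
    twoShell_weighted_sum_le_of_le h hA hR hU hUu hμ hK hβ hj'0 hε h2Λ hE0 q hr hrw
  have hrw' : r ≤ klTorusNorm L (-q) := by rw [hq, neg_sub, klvr_klTorusNorm_sub_comm]; exact hrw
  have hWnq : ∑ p ∈ univ.filter (fun p : FreqMomentum L M => matsubaraFreq β M p.1 ^ 2 + nambuXiCT L μ K p.2 ^ 2 ≤ klScale klE0 j' ^ 2 ∧
      |nambuXiCT L μ K (p.2 - -q)| ≤ Λ), (Real.sqrt (matsubaraFreq β M p.1 ^ 2 + nambuXiCT L μ K p.2 ^ 2))⁻¹ ≤ W :=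
    twoShell_weighted_sum_le_of_le h hA hR hU hUu hμ hK hβ hj'0 hε h2Λ hE0 (-q) hr hrw'
  -- abbreviations for the two weights
  set D : FreqMomentum L M → ℝ := fun p => softSymbolCompl L M β μ K (n + 1) j p - softSymbolCompl L M β μ K (n + 1) j' p with hDdef
  set Wd : FreqMomentum L M → ℝ := fun p => deriv (fun Λ' : ℝ => hubbardCutoffWeightCT L M β μ K Λ' p) Λ with hWddef
  -- step 1: collapse the partner sum and the spin sum
  have hcollapse : ∀ p : FreqMomentum L M,
      (∑ _σ : Fin 2, ∑ p' : FreqMomentum L M,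
        (if matsubaraInt M p'.1 + matsubaraInt M (omega0 M) = matsubaraInt M p.1 + matsubaraInt M (omega0 M) ∧ p'.2 = p.2 + x - y then
          ‖(((D p : ℝ) : ℂ) * (((β * (L : ℝ) ^ 2 : ℝ) : ℂ) * propCT L M β μ K p)) * (((Wd p' : ℝ) : ℂ) * (((β * (L : ℝ) ^ 2 : ℝ) : ℂ) * propCT L M β μ K p')) +
            (((Wd p : ℝ) : ℂ) * (((β * (L : ℝ) ^ 2 : ℝ) : ℂ) * propCT L M β μ K p)) * (((D p' : ℝ) : ℂ) * (((β * (L : ℝ) ^ 2 : ℝ) : ℂ) * propCT L M β μ K p'))‖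
        else 0)) =
      2 * ‖(((D p : ℝ) : ℂ) * (((β * (L : ℝ) ^ 2 : ℝ) : ℂ) * propCT L M β μ K p)) *
            (((Wd (p.1, p.2 + q) : ℝ) : ℂ) * (((β * (L : ℝ) ^ 2 : ℝ) : ℂ) * propCT L M β μ K (p.1, p.2 + q))) +
          (((Wd p : ℝ) : ℂ) * (((β * (L : ℝ) ^ 2 : ℝ) : ℂ) * propCT L M β μ K p)) *
            (((D (p.1, p.2 + q) : ℝ) : ℂ) * (((β * (L : ℝ) ^ 2 : ℝ) : ℂ) * propCT L M β μ K (p.1, p.2 + q)))‖ := by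
    intro p
    rw [sum_partner_ite_eq x y p, Finset.sum_const, Finset.card_univ, Fintype.card_fin, nsmul_eq_mul]
    have e : p.2 + x - y = p.2 + q := by rw [hq]; abel
    rw [e]
    norm_num
  -- step 2: the two products against the indicators
  have hT : ∀ p : FreqMomentum L M,
      ‖(((D p : ℝ) : ℂ) * (((β * (L : ℝ) ^ 2 : ℝ) : ℂ) * propCT L M β μ K p)) *
            (((Wd (p.1, p.2 + q) : ℝ) : ℂ) * (((β * (L : ℝ) ^ 2 : ℝ) : ℂ) * propCT L M β μ K (p.1, p.2 + q))) +
          (((Wd p : ℝ) : ℂ) * (((β * (L : ℝ) ^ 2 : ℝ) : ℂ) * propCT L M β μ K p)) *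
            (((D (p.1, p.2 + q) : ℝ) : ℂ) * (((β * (L : ℝ) ^ 2 : ℝ) : ℂ) * propCT L M β μ K (p.1, p.2 + q)))‖ ≤
      (β * (L : ℝ) ^ 2) ^ 2 * (128 / (3 * Λ ^ 2)) *
        (if matsubaraFreq β M p.1 ^ 2 + nambuXiCT L μ K p.2 ^ 2 ≤ klScale klE0 j' ^ 2 ∧ |nambuXiCT L μ K (p.2 + q)| ≤ Λ then
          (Real.sqrt (matsubaraFreq β M p.1 ^ 2 + nambuXiCT L μ K p.2 ^ 2))⁻¹ else 0) +
      (β * (L : ℝ) ^ 2) ^ 2 * (128 / (3 * Λ ^ 2)) *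
        (if matsubaraFreq β M (p.1, p.2 + q).1 ^ 2 + nambuXiCT L μ K (p.1, p.2 + q).2 ^ 2 ≤ klScale klE0 j' ^ 2 ∧
            |nambuXiCT L μ K ((p.1, p.2 + q).2 + -q)| ≤ Λ then
          (Real.sqrt (matsubaraFreq β M (p.1, p.2 + q).1 ^ 2 + nambuXiCT L μ K (p.1, p.2 + q).2 ^ 2))⁻¹ else 0) := by
    intro p
    refine (norm_add_le _ _).trans (add_le_add ?_ ?_)
    · rw [norm_weightProd_eq hβ]
      exact dirProd_le_indicator hβ μ K n hjj hΛ q p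
    · rw [norm_weightProd_eq hβ]
      have h := dirProd_le_indicator hβ μ K n hjj hΛ (-q) (p.1, p.2 + q)
      have e : (p.1, p.2 + q).2 + -q = p.2 := by simp
      simp only [e] at h ⊢
      calc |Wd p| * ((β * (L : ℝ) ^ 2) * ‖propCT L M β μ K p‖) * (|D (p.1, p.2 + q)| * ((β * (L : ℝ) ^ 2) * ‖propCT L M β μ K (p.1, p.2 + q)‖))
          = |D (p.1, p.2 + q)| * ((β * (L : ℝ) ^ 2) * ‖propCT L M β μ K (p.1, p.2 + q)‖) * (|Wd (p.1, p.2)| * ((β * (L : ℝ) ^ 2) * ‖propCT L M β μ K (p.1, p.2)‖)) := by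
            simp only [Prod.mk.eta]; ring
        _ ≤ _ := h
  -- step 3: sum, and recognise the two weighted two-shell masses (the second after the shift `k ↦ k + q`)
  have hS1 : ∑ p : FreqMomentum L M,
      (if matsubaraFreq β M p.1 ^ 2 + nambuXiCT L μ K p.2 ^ 2 ≤ klScale klE0 j' ^ 2 ∧ |nambuXiCT L μ K (p.2 + q)| ≤ Λ then
          (Real.sqrt (matsubaraFreq β M p.1 ^ 2 + nambuXiCT L μ K p.2 ^ 2))⁻¹ else 0) ≤ W := by
    rw [← Finset.sum_filter]
    have e : (univ.filter fun p : FreqMomentum L M => matsubaraFreq β M p.1 ^ 2 + nambuXiCT L μ K p.2 ^ 2 ≤ klScale klE0 j' ^ 2 ∧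
        |nambuXiCT L μ K (p.2 + q)| ≤ Λ) = univ.filter fun p : FreqMomentum L M => matsubaraFreq β M p.1 ^ 2 + nambuXiCT L μ K p.2 ^ 2 ≤ klScale klE0 j' ^ 2 ∧
        |nambuXiCT L μ K (p.2 - -q)| ≤ Λ := by
      congr 1; funext p; rw [sub_neg_eq_add]
    rw [e]; exact hWnq
  have hS2 : ∑ p : FreqMomentum L M,
      (if matsubaraFreq β M (p.1, p.2 + q).1 ^ 2 + nambuXiCT L μ K (p.1, p.2 + q).2 ^ 2 ≤ klScale klE0 j' ^ 2 ∧
            |nambuXiCT L μ K ((p.1, p.2 + q).2 + -q)| ≤ Λ then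
          (Real.sqrt (matsubaraFreq β M (p.1, p.2 + q).1 ^ 2 + nambuXiCT L μ K (p.1, p.2 + q).2 ^ 2))⁻¹ else 0) ≤ W := by
    set g : FreqMomentum L M → ℝ := fun p' => if matsubaraFreq β M p'.1 ^ 2 + nambuXiCT L μ K p'.2 ^ 2 ≤ klScale klE0 j' ^ 2 ∧
        |nambuXiCT L μ K (p'.2 + -q)| ≤ Λ then (Real.sqrt (matsubaraFreq β M p'.1 ^ 2 + nambuXiCT L μ K p'.2 ^ 2))⁻¹ else 0 with hg
    set e : FreqMomentum L M ≃ FreqMomentum L M := Equiv.prodCongr (Equiv.refl _) (Equiv.addRight q) with hedef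
    have hsum : ∑ p : FreqMomentum L M, g (e p) = ∑ p : FreqMomentum L M, g p := Equiv.sum_comp e g
    have e1 : ∀ p : FreqMomentum L M, e p = (p.1, p.2 + q) := fun p => rfl
    simp only [e1, hg] at hsum
    rw [hsum, ← Finset.sum_filter]
    have e2 : (univ.filter fun p : FreqMomentum L M => matsubaraFreq β M p.1 ^ 2 + nambuXiCT L μ K p.2 ^ 2 ≤ klScale klE0 j' ^ 2 ∧
        |nambuXiCT L μ K (p.2 + -q)| ≤ Λ) = univ.filter fun p : FreqMomentum L M => matsubaraFreq β M p.1 ^ 2 + nambuXiCT L μ K p.2 ^ 2 ≤ klScale klE0 j' ^ 2 ∧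
        |nambuXiCT L μ K (p.2 - q)| ≤ Λ := by
      congr 1; funext p; rw [← sub_eq_add_neg]
    rw [e2]; exact hWq
  -- assemble
  have hc : 0 ≤ (β * (L : ℝ) ^ 2) ^ 2 * (128 / (3 * Λ ^ 2)) := by positivity
  calc _ = ∑ p : FreqMomentum L M, 2 * ‖(((D p : ℝ) : ℂ) * (((β * (L : ℝ) ^ 2 : ℝ) : ℂ) * propCT L M β μ K p)) *
            (((Wd (p.1, p.2 + q) : ℝ) : ℂ) * (((β * (L : ℝ) ^ 2 : ℝ) : ℂ) * propCT L M β μ K (p.1, p.2 + q))) +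
          (((Wd p : ℝ) : ℂ) * (((β * (L : ℝ) ^ 2 : ℝ) : ℂ) * propCT L M β μ K p)) *
            (((D (p.1, p.2 + q) : ℝ) : ℂ) * (((β * (L : ℝ) ^ 2 : ℝ) : ℂ) * propCT L M β μ K (p.1, p.2 + q)))‖ := Finset.sum_congr rfl fun p _ => hcollapse p
    _ ≤ ∑ p : FreqMomentum L M, 2 * ((β * (L : ℝ) ^ 2) ^ 2 * (128 / (3 * Λ ^ 2)) *
        (if matsubaraFreq β M p.1 ^ 2 + nambuXiCT L μ K p.2 ^ 2 ≤ klScale klE0 j' ^ 2 ∧ |nambuXiCT L μ K (p.2 + q)| ≤ Λ then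
          (Real.sqrt (matsubaraFreq β M p.1 ^ 2 + nambuXiCT L μ K p.2 ^ 2))⁻¹ else 0) +
      (β * (L : ℝ) ^ 2) ^ 2 * (128 / (3 * Λ ^ 2)) *
        (if matsubaraFreq β M (p.1, p.2 + q).1 ^ 2 + nambuXiCT L μ K (p.1, p.2 + q).2 ^ 2 ≤ klScale klE0 j' ^ 2 ∧
            |nambuXiCT L μ K ((p.1, p.2 + q).2 + -q)| ≤ Λ then
          (Real.sqrt (matsubaraFreq β M (p.1, p.2 + q).1 ^ 2 + nambuXiCT L μ K (p.1, p.2 + q).2 ^ 2))⁻¹ else 0)) :=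
        Finset.sum_le_sum fun p _ => mul_le_mul_of_nonneg_left (hT p) (by norm_num)
    _ = 2 * ((β * (L : ℝ) ^ 2) ^ 2 * (128 / (3 * Λ ^ 2))) * (∑ p : FreqMomentum L M,
        (if matsubaraFreq β M p.1 ^ 2 + nambuXiCT L μ K p.2 ^ 2 ≤ klScale klE0 j' ^ 2 ∧ |nambuXiCT L μ K (p.2 + q)| ≤ Λ then
          (Real.sqrt (matsubaraFreq β M p.1 ^ 2 + nambuXiCT L μ K p.2 ^ 2))⁻¹ else 0) +
        ∑ p : FreqMomentum L M, (if matsubaraFreq β M (p.1, p.2 + q).1 ^ 2 + nambuXiCT L μ K (p.1, p.2 + q).2 ^ 2 ≤ klScale klE0 j' ^ 2 ∧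
            |nambuXiCT L μ K ((p.1, p.2 + q).2 + -q)| ≤ Λ then
          (Real.sqrt (matsubaraFreq β M (p.1, p.2 + q).1 ^ 2 + nambuXiCT L μ K (p.1, p.2 + q).2 ^ 2))⁻¹ else 0)) := by
        rw [← Finset.sum_add_distrib, Finset.mul_sum]
        exact Finset.sum_congr rfl fun p _ => by ring
    _ ≤ 2 * ((β * (L : ℝ) ^ 2) ^ 2 * (128 / (3 * Λ ^ 2))) * (W + W) := by gcongr
    _ = 512 / 3 * (β * (L : ℝ) ^ 2) ^ 2 / Λ ^ 2 * W := by field_simp; ring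

/-- **`WDx ≤` the weighted two-shell mass at a general partner radius, every pair `n + 1 ≤ j′ ≤ j` (edge included)** — the crossed twin at transfer
`x + y − Q_m` (`256/3`; partner radius `ε₂′` with `Λ(t) ≤ ε₂′`, `2Λ_{j′} ≤ ε₂′`, `ε₂′ + Gδ ≤ klE0`). -/
theorem WDx_sum_le_twoShell_edge_gen [NeZero L] [NeZero M] {A : ℝ} {u : RenConsts → ℝ} (h : TwoShellFrameAreaAt A u) (hA : 0 ≤ A) {R : RenConsts}
    (hR : R.WF2) {U : ℝ} (hU : 0 < U) (hUu : U ≤ u R) (hμ : μ ∈ klWindowC) {N : ℕ} (hK : FrameOK R U N μ K) (hβ : 0 < β)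
    (n : ℕ) {j j' : ℕ} (hjj : j' ≤ j) {t : ℝ} (ht : t ∈ Icc (0 : ℝ) 1) {ε₂' : ℝ}
    (hε : klScale klE0 n + t * (klScale klE0 (n + 1) - klScale klE0 n) ≤ ε₂') (h2Λ : 2 * klScale klE0 j' ≤ ε₂')
    (hE0 : ε₂' + (4 + 8 / 3 * R.Gfr 1 * U ^ 2) * (2 * π / L) ≤ klE0) {Qm x y : TorusSite 2 L} {r : ℝ} (hr : 0 < r)
    (hrw : r ≤ klTorusNorm L (x + y - Qm)) :
    ∑ p : FreqMomentum L M, ∑ p' : FreqMomentum L M,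
      (if matsubaraInt M p'.1 + matsubaraInt M (omega0 M) + matsubaraInt M (omega0 M) + 1 = matsubaraInt M p.1 ∧ p'.2 = p.2 + Qm - x - y then
        ‖((((softSymbolCompl L M β μ K (n + 1) j p - softSymbolCompl L M β μ K (n + 1) j' p : ℝ)) : ℂ) * (((β * (L : ℝ) ^ 2 : ℝ) : ℂ) * propCT L M β μ K p)) *
            ((((deriv (fun Λ' : ℝ => hubbardCutoffWeightCT L M β μ K Λ' p') (klScale klE0 n + t * (klScale klE0 (n + 1) - klScale klE0 n)) : ℝ)) : ℂ) *
              (((β * (L : ℝ) ^ 2 : ℝ) : ℂ) * propCT L M β μ K p')) +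
          ((((deriv (fun Λ' : ℝ => hubbardCutoffWeightCT L M β μ K Λ' p) (klScale klE0 n + t * (klScale klE0 (n + 1) - klScale klE0 n)) : ℝ)) : ℂ) *
              (((β * (L : ℝ) ^ 2 : ℝ) : ℂ) * propCT L M β μ K p)) *
            ((((softSymbolCompl L M β μ K (n + 1) j p' - softSymbolCompl L M β μ K (n + 1) j' p' : ℝ)) : ℂ) * (((β * (L : ℝ) ^ 2 : ℝ) : ℂ) * propCT L M β μ K p'))‖
      else 0) ≤
      256 / 3 * (β * (L : ℝ) ^ 2) ^ 2 / (klScale klE0 n + t * (klScale klE0 (n + 1) - klScale klE0 n)) ^ 2 *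
        (9 * A * (L : ℝ) ^ 2 / (2 * π ^ 2) *
          ((ε₂' + (4 + 8 / 3 * R.Gfr 1 * U ^ 2) * (2 * π / L)) / r +
            Real.sqrt (ε₂' + (4 + 8 / 3 * R.Gfr 1 * U ^ 2) * (2 * π / L))) *
          (β * klScale klE0 j' / π * (10 + 2 * (4 + 8 / 3 * R.Gfr 1 * U ^ 2) * β / L) + 12 * (4 + 8 / 3 * R.Gfr 1 * U ^ 2) * β / L)) := by
  classical
  set Λ : ℝ := klScale klE0 n + t * (klScale klE0 (n + 1) - klScale klE0 n) with hΛdef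
  have hΛ : 0 < Λ := scaleAt_pos n ht
  have hβL : 0 < β * (L : ℝ) ^ 2 := by
    have : (0 : ℝ) < L := by exact_mod_cast Nat.pos_of_ne_zero (NeZero.ne L)
    positivity
  set G : ℝ := 4 + 8 / 3 * R.Gfr 1 * U ^ 2 with hG
  set q : TorusSite 2 L := Qm - x - y with hq
  have hj'0 := klth_klScale_pos j'
  set W : ℝ := 9 * A * (L : ℝ) ^ 2 / (2 * π ^ 2) * ((ε₂' + G * (2 * π / L)) / r + Real.sqrt (ε₂' + G * (2 * π / L))) *
      (β * klScale klE0 j' / π * (10 + 2 * G * β / L) + 12 * G * β / L) with hW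
  have hrq : r ≤ klTorusNorm L q := by rw [hq, show Qm - x - y = -(x + y - Qm) by abel, klvr_klTorusNorm_neg]; exact hrw
  have hrnq : r ≤ klTorusNorm L (-q) := by rw [hq, show -(Qm - x - y) = x + y - Qm by abel]; exact hrw
  have hWq : ∑ p ∈ univ.filter (fun p : FreqMomentum L M => matsubaraFreq β M p.1 ^ 2 + nambuXiCT L μ K p.2 ^ 2 ≤ klScale klE0 j' ^ 2 ∧
      |nambuXiCT L μ K (p.2 - q)| ≤ Λ), (Real.sqrt (matsubaraFreq β M p.1 ^ 2 + nambuXiCT L μ K p.2 ^ 2))⁻¹ ≤ W :=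
    twoShell_weighted_sum_le_of_le h hA hR hU hUu hμ hK hβ hj'0 hε h2Λ hE0 q hr hrq
  have hWnq : ∑ p ∈ univ.filter (fun p : FreqMomentum L M => matsubaraFreq β M p.1 ^ 2 + nambuXiCT L μ K p.2 ^ 2 ≤ klScale klE0 j' ^ 2 ∧
      |nambuXiCT L μ K (p.2 - -q)| ≤ Λ), (Real.sqrt (matsubaraFreq β M p.1 ^ 2 + nambuXiCT L μ K p.2 ^ 2))⁻¹ ≤ W :=
    twoShell_weighted_sum_le_of_le h hA hR hU hUu hμ hK hβ hj'0 hε h2Λ hE0 (-q) hr hrnq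
  have hW0 : 0 ≤ W := le_trans (Finset.sum_nonneg fun p _ => inv_nonneg.2 (Real.sqrt_nonneg _)) hWq
  -- abbreviations
  set D : FreqMomentum L M → ℝ := fun p => softSymbolCompl L M β μ K (n + 1) j p - softSymbolCompl L M β μ K (n + 1) j' p with hDdef
  set Wd : FreqMomentum L M → ℝ := fun p => deriv (fun Λ' : ℝ => hubbardCutoffWeightCT L M β μ K Λ' p) Λ with hWddef
  set c : FreqMomentum L M → FreqMomentum L M → Prop := fun p p' =>
    matsubaraInt M p'.1 + matsubaraInt M (omega0 M) + matsubaraInt M (omega0 M) + 1 = matsubaraInt M p.1 ∧ p'.2 = p.2 + Qm - x - y with hc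
  set C0 : ℝ := (β * (L : ℝ) ^ 2) ^ 2 * (128 / (3 * Λ ^ 2)) with hC0
  have hC00 : 0 ≤ C0 := by positivity
  -- the two indicator functions
  set gA : FreqMomentum L M → ℝ := fun p => if matsubaraFreq β M p.1 ^ 2 + nambuXiCT L μ K p.2 ^ 2 ≤ klScale klE0 j' ^ 2 ∧
      |nambuXiCT L μ K (p.2 + q)| ≤ Λ then (Real.sqrt (matsubaraFreq β M p.1 ^ 2 + nambuXiCT L μ K p.2 ^ 2))⁻¹ else 0 with hgA
  set gB : FreqMomentum L M → ℝ := fun p' => if matsubaraFreq β M p'.1 ^ 2 + nambuXiCT L μ K p'.2 ^ 2 ≤ klScale klE0 j' ^ 2 ∧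
      |nambuXiCT L μ K (p'.2 - q)| ≤ Λ then (Real.sqrt (matsubaraFreq β M p'.1 ^ 2 + nambuXiCT L μ K p'.2 ^ 2))⁻¹ else 0 with hgB
  have hgA0 : ∀ p, 0 ≤ gA p := fun p => by simp only [hgA]; split_ifs <;> positivity
  have hgB0 : ∀ p, 0 ≤ gB p := fun p => by simp only [hgB]; split_ifs <;> positivity
  -- step 1: split the summand
  have hsplit : ∀ p p' : FreqMomentum L M,
      (if c p p' then ‖(((D p : ℝ) : ℂ) * (((β * (L : ℝ) ^ 2 : ℝ) : ℂ) * propCT L M β μ K p)) * (((Wd p' : ℝ) : ℂ) * (((β * (L : ℝ) ^ 2 : ℝ) : ℂ) * propCT L M β μ K p')) +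
          (((Wd p : ℝ) : ℂ) * (((β * (L : ℝ) ^ 2 : ℝ) : ℂ) * propCT L M β μ K p)) * (((D p' : ℝ) : ℂ) * (((β * (L : ℝ) ^ 2 : ℝ) : ℂ) * propCT L M β μ K p'))‖ else 0) ≤
      (if c p p' then |D p| * ((β * (L : ℝ) ^ 2) * ‖propCT L M β μ K p‖) * (|Wd p'| * ((β * (L : ℝ) ^ 2) * ‖propCT L M β μ K p'‖)) else 0) +
      (if c p p' then |D p'| * ((β * (L : ℝ) ^ 2) * ‖propCT L M β μ K p'‖) * (|Wd p| * ((β * (L : ℝ) ^ 2) * ‖propCT L M β μ K p‖)) else 0) := by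
    intro p p'
    split_ifs with hcc
    · refine (norm_add_le _ _).trans (add_le_add (le_of_eq (norm_weightProd_eq hβ μ K _ _ p p')) (le_of_eq ?_))
      rw [norm_weightProd_eq hβ μ K]; ring
    · simp
  -- step 2: part A — collapse the partner sum at fixed `p`
  have hA' : ∀ p : FreqMomentum L M,
      (∑ p' : FreqMomentum L M, if c p p' then |D p| * ((β * (L : ℝ) ^ 2) * ‖propCT L M β μ K p‖) * (|Wd p'| * ((β * (L : ℝ) ^ 2) * ‖propCT L M β μ K p'‖)) else 0) ≤
      C0 * gA p := by
    intro p
    refine sum_ite_le_of_card_le_one _ _ _ (mul_nonneg hC00 (hgA0 p)) (fun p' _ hcc => ?_) (card_partner_le_one Qm x y p)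
    have hb := crossProd_le_indicator hβ μ K n hjj hΛ p p'
    have e : p'.2 = p.2 + q := by rw [hcc.2, hq]; abel
    rw [e] at hb
    exact hb
  -- step 3: part B — collapse the source sum at fixed `p′`
  have hB' : ∀ p' : FreqMomentum L M,
      (∑ p : FreqMomentum L M, if c p p' then |D p'| * ((β * (L : ℝ) ^ 2) * ‖propCT L M β μ K p'‖) * (|Wd p| * ((β * (L : ℝ) ^ 2) * ‖propCT L M β μ K p‖)) else 0) ≤
      C0 * gB p' := by
    intro p'
    refine sum_ite_le_of_card_le_one _ (fun p => c p p') _ (mul_nonneg hC00 (hgB0 p')) (fun p _ hcc => ?_) (card_source_le_one Qm x y p')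
    have hb := crossProd_le_indicator hβ μ K n hjj hΛ p' p
    have e : p.2 = p'.2 - q := by rw [hcc.2, hq]; abel
    rw [e] at hb
    exact hb
  -- step 4: the two weighted sums
  have hSA : ∑ p : FreqMomentum L M, gA p ≤ W := by
    rw [hgA, ← Finset.sum_filter]
    have e : (univ.filter fun p : FreqMomentum L M => matsubaraFreq β M p.1 ^ 2 + nambuXiCT L μ K p.2 ^ 2 ≤ klScale klE0 j' ^ 2 ∧
        |nambuXiCT L μ K (p.2 + q)| ≤ Λ) = univ.filter fun p : FreqMomentum L M => matsubaraFreq β M p.1 ^ 2 + nambuXiCT L μ K p.2 ^ 2 ≤ klScale klE0 j' ^ 2 ∧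
        |nambuXiCT L μ K (p.2 - -q)| ≤ Λ := by
      congr 1; funext p; rw [sub_neg_eq_add]
    rw [e]; exact hWnq
  have hSB : ∑ p : FreqMomentum L M, gB p ≤ W := by
    rw [hgB, ← Finset.sum_filter]; exact hWq
  -- assemble
  calc _ ≤ ∑ p : FreqMomentum L M, ∑ p' : FreqMomentum L M,
        ((if c p p' then |D p| * ((β * (L : ℝ) ^ 2) * ‖propCT L M β μ K p‖) * (|Wd p'| * ((β * (L : ℝ) ^ 2) * ‖propCT L M β μ K p'‖)) else 0) +
         (if c p p' then |D p'| * ((β * (L : ℝ) ^ 2) * ‖propCT L M β μ K p'‖) * (|Wd p| * ((β * (L : ℝ) ^ 2) * ‖propCT L M β μ K p‖)) else 0)) :=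
        Finset.sum_le_sum fun p _ => Finset.sum_le_sum fun p' _ => hsplit p p'
    _ = ∑ p : FreqMomentum L M, ∑ p' : FreqMomentum L M,
          (if c p p' then |D p| * ((β * (L : ℝ) ^ 2) * ‖propCT L M β μ K p‖) * (|Wd p'| * ((β * (L : ℝ) ^ 2) * ‖propCT L M β μ K p'‖)) else 0) +
        ∑ p' : FreqMomentum L M, ∑ p : FreqMomentum L M,
          (if c p p' then |D p'| * ((β * (L : ℝ) ^ 2) * ‖propCT L M β μ K p'‖) * (|Wd p| * ((β * (L : ℝ) ^ 2) * ‖propCT L M β μ K p‖)) else 0) := by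
        rw [Finset.sum_comm (f := fun p' p => if c p p' then |D p'| * ((β * (L : ℝ) ^ 2) * ‖propCT L M β μ K p'‖) *
          (|Wd p| * ((β * (L : ℝ) ^ 2) * ‖propCT L M β μ K p‖)) else 0), ← Finset.sum_add_distrib]
        exact Finset.sum_congr rfl fun p _ => Finset.sum_add_distrib
    _ ≤ ∑ p : FreqMomentum L M, C0 * gA p + ∑ p' : FreqMomentum L M, C0 * gB p' := add_le_add (Finset.sum_le_sum fun p _ => hA' p) (Finset.sum_le_sum fun p' _ => hB' p')
    _ = C0 * (∑ p : FreqMomentum L M, gA p + ∑ p' : FreqMomentum L M, gB p') := by rw [mul_add, Finset.mul_sum, Finset.mul_sum]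
    _ ≤ C0 * (W + W) := by gcongr
    _ = 256 / 3 * (β * (L : ℝ) ^ 2) ^ 2 / Λ ^ 2 * W := by rw [hC0]; field_simp; ring

end Summit.HubbardSuperconductivity.HubbardSuperconductivity.Theorems.KLRegimeSplit

end
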